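import Mathlib
import HarnessLib
import Summits.Ventures.LatticeQCDFlow.Scaling.JarzynskiSampleSize

/-!
# SampleSizeIdenticalMarginals — the NECESSITY half of Chatterjee–Diaconis needs no independence:
# for ANY joint law of `N` draws whose one-draw marginals are the proposal (e.g. the evolutions of
# a STATIONARY RESTART CHAIN), `N ≤ e^{L − t}` still forces the importance-sampling / Jarzynski
# estimator below `(1 − δ)×` its mean except on an event of probability `≤ e^{−t/2} + P_p{log(p/q) ≤ L − t/2}/(1 − δ)`

HONEST FRAMING: exact (Metropolis-corrected) sampling algorithms for lattice gauge theory;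
figures of merit are autocorrelation/cost numbers at stated couplings and volumes; no
continuum-physics claim.

Venture `LatticeQCDFlow` (cell pub-lqcd), topic `Scaling`; FANOUT row 19 (`su2-snf`, GEN-7).
OUR WORK (elementary finite sums), nothing cited as a fact.  The Literature's sample-size
result of Chatterjee–Diaconis (`ImportanceSampling/ChatterjeeDiaconis`, Thm 1.1) and its dockings
`Scaling/JarzynskiSampleSize` / `KishSampleSize` (this seat) are stated for INDEPENDENT draws
(`Measure.pi`).  The row's NE-MCMC arms do not draw independent evolutions: one prior chain is run
and an evolution is launched every `n_between` sweeps (CARD-su2-snf §2), so consecutive evolutions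
are correlated through their starting configurations.  OBSERVATION (the printed proof of the
necessity half, [Chatterjee–Diaconis 2018, §4], read line by line): it uses ONLY a union bound over
the draws and Markov's inequality for one-draw quantities — i.e. only that EACH draw has the
proposal law.  Hence:

* `sum_blockProd_const_mul_apply` — the i.i.d. law `blockProd (fun _ => q)` has one-draw marginals
  `q` (the independent case is an instance of everything below);
* **`sampleSize_necessary_of_marginals`** — finite laws `q > 0` (proposal), `p ≥ 0` (target),
  `L = klFin p q`; ANY joint law `Q ≥ 0`, `Σ Q = 1` on `Fin N → Ω` whose every one-draw marginal is
  `q` (`Σ_x Q(x) g(x i) = Σ_ω q(ω) g(ω)` for all `i`, `g`); `t ≥ 0`, `N ≤ e^{L − t}`, `δ ∈ (0,1)`: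
  `Q{ x | (1/N) Σᵢ p(xᵢ)/q(xᵢ) ≥ 1 − δ } ≤ e^{−t/2} + P_p{ log(p/q) ≤ L − t/2 }/(1 − δ)`;
* **`jarzynski_sampleSize_necessary_of_marginals`** — the NE-MCMC reading: for ANY joint law of
  `N` forward evolutions each distributed as `P_F` (in particular the stationary restart chain),
  `N ≤ exp(ΔF − ⟨W⟩_R̃ − t)` ⇒ `Q{Ẑ_N e^{ΔF} ≥ 1 − δ} ≤ e^{−t/2} + P̃_R{W ≥ ⟨W⟩_R̃ + t/2}/(1 − δ)`.

So the row's 'too few evolutions ⇒ ΔF̂ over-estimates / Kish over-optimistic' diagnosis does not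
depend on the independence idealisation.  NOT CLAIMED: the SUFFICIENCY half for correlated draws
(it needs a variance bound, i.e. the restart chain's autocorrelation — row 8's
`Scoring/RestartChain*` files); anything about non-stationary starts.
-/

namespace Summit.Ventures.LatticeQCDFlow.Theory2

open Finset
open Literature.Probability.MarkovChains (IsRowStochastic IsStationary)
open Summit.Ventures.LatticeQCDFlow.Exactness

variable {Ω : Type*} [Fintype Ω]

/-! ## §1 Two finite-sum inequalities: union bound and Markov -/

/-- Finite Markov inequality: for `Q, Z ≥ 0` and `c > 0`, `Q{Z ≥ c} ≤ (Σ Q Z)/c`. -/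
theorem sum_filter_le_sum_mul_div {X : Type*} [Fintype X] {Q Z : X → ℝ} (hQ : ∀ x, 0 ≤ Q x)
    (hZ : ∀ x, 0 ≤ Z x) {c : ℝ} (hc : 0 < c) [DecidablePred fun x => c ≤ Z x] :
    ∑ x ∈ univ.filter (fun x => c ≤ Z x), Q x ≤ (∑ x, Q x * Z x) / c := by
  rw [le_div_iff₀ hc, sum_mul]
  calc ∑ x ∈ univ.filter (fun x => c ≤ Z x), Q x * c
      ≤ ∑ x ∈ univ.filter (fun x => c ≤ Z x), Q x * Z x :=
        sum_le_sum fun x hx => mul_le_mul_of_nonneg_left (mem_filter.mp hx).2 (hQ x)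
    _ ≤ ∑ x, Q x * Z x :=
        sum_le_sum_of_subset_of_nonneg (filter_subset _ _) fun x _ _ => mul_nonneg (hQ x) (hZ x)

/-- Finite union bound: `Q{∃ i, P i x} ≤ Σ_i Q{P i x}` for `Q ≥ 0`. -/
theorem sum_filter_exists_le {X I : Type*} [Fintype X] [Fintype I] {Q : X → ℝ} (hQ : ∀ x, 0 ≤ Q x)
    (P : I → X → Prop) [∀ i, DecidablePred (P i)] [DecidablePred fun x => ∃ i, P i x] :
    ∑ x ∈ univ.filter (fun x => ∃ i, P i x), Q x ≤ ∑ i, ∑ x ∈ univ.filter (P i), Q x := by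
  simp_rw [sum_filter]
  rw [sum_comm]
  refine sum_le_sum fun x _ => ?_
  by_cases hx : ∃ i, P i x
  · obtain ⟨i, hi⟩ := hx
    rw [if_pos ⟨i, hi⟩]
    calc Q x = ∑ j ∈ ({i} : Finset I), (if P j x then Q x else 0) := by simp [hi]
      _ ≤ ∑ j, (if P j x then Q x else 0) :=
          sum_le_sum_of_subset_of_nonneg (subset_univ _) fun j _ _ => by
            split_ifs
            · exact hQ x
            · exact le_rfl
  · rw [if_neg hx]
    exact sum_nonneg fun j _ => by
      split_ifs
      · exact hQ x
      · exact le_rfl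

/-- The i.i.d. law IS an instance: the one-draw marginals of theory-2's block-product law
`blockProd (fun _ => q)` (`Scaling/ImportanceWeights`) are `q` — so every statement below contains
the independent case. -/
theorem sum_blockProd_const_mul_apply {N : ℕ} (q : Ω → ℝ) (hq1 : ∑ ω, q ω = 1) (i : Fin N)
    (g : Ω → ℝ) :
    ∑ x : Fin N → Ω, blockProd (fun _ : Fin N => q) x * g (x i) = ∑ ω, q ω * g ω := by
  classical
  have e1 : ∀ x : Fin N → Ω, blockProd (fun _ : Fin N => q) x * g (x i)
      = ∏ j, (q (x j) * if j = i then g (x j) else 1) := by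
    intro x
    rw [blockProd, prod_mul_distrib, prod_ite_eq']
    simp
  simp_rw [e1]
  rw [← Fintype.prod_sum (fun j z => q z * if j = i then g z else 1),
    Fintype.prod_eq_mul_prod_compl i]
  simp only [if_true]
  have e2 : ∏ j ∈ ({i}ᶜ : Finset (Fin N)), ∑ z, q z * (if j = i then g z else 1) = 1 := by
    refine prod_eq_one fun j hj => ?_
    have hji : j ≠ i := by simpa using hj
    simp [hji, hq1]
  rw [e2, mul_one]

/-! ## §2 Chatterjee–Diaconis necessity from identical marginals alone -/

/-- **CHATTERJEE–DIACONIS, NECESSITY, IDENTICAL MARGINALS (no independence).**  Finite laws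
`q > 0` (proposal) and `p ≥ 0` (target), both normalised, `L = klFin p q`; a joint law `Q ≥ 0`,
of `N` draws whose EVERY one-draw marginal is `q` (no normalisation of `Q` is even needed); any real
`t` with `N ≤ e^{L − t}` and any `δ < 1`.  Then `Q{x | (1/N)Σᵢ p(xᵢ)/q(xᵢ) ≥ 1 − δ} ≤ e^{−t/2} + P_p{log(p/q) ≤ L − t/2}/(1 − δ)`
(union bound over the draws + Markov twice, exactly the printed proof, which never uses
independence in this half). -/
theorem sampleSize_necessary_of_marginals {p q : Ω → ℝ} (hq : ∀ ω, 0 < q ω)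
    (hp : ∀ ω, 0 ≤ p ω) (hp1 : ∑ ω, p ω = 1) {N : ℕ} {Q : (Fin N → Ω) → ℝ} (hQ : ∀ x, 0 ≤ Q x)
    (hmarg : ∀ (i : Fin N) (g : Ω → ℝ), ∑ x, Q x * g (x i) = ∑ ω, q ω * g ω)
    {t : ℝ} (hN : (N : ℝ) ≤ Real.exp (klFin p q - t)) {δ : ℝ} (hδ1 : δ < 1) :
    ∑ x ∈ univ.filter (fun x => 1 - δ ≤ (1 / (N : ℝ)) * ∑ i, p (x i) / q (x i)), Q x
      ≤ Real.exp (-t / 2)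
        + (∑ ω, if Real.log (p ω / q ω) ≤ klFin p q - t / 2 then p ω else 0) / (1 - δ) := by
  classical
  have hRHS0 : 0 ≤ Real.exp (-t / 2)
      + (∑ ω, if Real.log (p ω / q ω) ≤ klFin p q - t / 2 then p ω else 0) / (1 - δ) :=
    add_nonneg (Real.exp_pos _).le (div_nonneg (sum_nonneg fun ω _ => by
      split_ifs
      · exact hp ω
      · exact le_rfl) (by linarith))
  -- the degenerate empty sample
  rcases Nat.eq_zero_or_pos N with hN0 | hNpos
  · subst hN0
    have hempty : univ.filter (fun x : Fin 0 → Ω => 1 - δ ≤ (1 / ((0 : ℕ) : ℝ))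
        * ∑ i, p (x i) / q (x i)) = ∅ := by
      refine filter_eq_empty_iff.mpr fun x _ => ?_
      simp only [CharP.cast_eq_zero, div_zero, zero_mul, not_le]
      linarith
    rw [hempty, sum_empty]
    exact hRHS0
  have hNr : (0 : ℝ) < N := Nat.cast_pos.mpr hNpos
  -- notation
  set L := klFin p q with hL
  set a := Real.exp (L - t / 2) with ha
  have ha0 : 0 < a := Real.exp_pos _
  have hρ0 : ∀ ω, 0 ≤ p ω / q ω := fun ω => div_nonneg (hp ω) (hq ω).le
  -- the truncated estimator `Z(x) = (1/N) Σ_i ρ(x i) 1{ρ(x i) ≤ a}`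
  let Z : (Fin N → Ω) → ℝ := fun x =>
    (1 / (N : ℝ)) * ∑ i, if p (x i) / q (x i) ≤ a then p (x i) / q (x i) else 0
  have hZdef : ∀ x, Z x
      = (1 / (N : ℝ)) * ∑ i, if p (x i) / q (x i) ≤ a then p (x i) / q (x i) else 0 :=
    fun x => rfl
  have hZ0 : ∀ x, 0 ≤ Z x := fun x => by
    rw [hZdef]
    exact mul_nonneg (by positivity) (sum_nonneg fun i _ => by
      split_ifs
      · exact hρ0 _
      · exact le_rfl)
  -- Step 1: split the event.
  have hsplit : ∀ x, 1 - δ ≤ (1 / (N : ℝ)) * ∑ i, p (x i) / q (x i) →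
      (∃ i, a < p (x i) / q (x i)) ∨ 1 - δ ≤ Z x := by
    intro x hx
    by_cases hex : ∃ i, a < p (x i) / q (x i)
    · exact Or.inl hex
    · right
      simp only [not_exists, not_lt] at hex
      have hZx : Z x = (1 / (N : ℝ)) * ∑ i, p (x i) / q (x i) := by
        rw [hZdef]
        congr 1
        exact sum_congr rfl fun i _ => by rw [if_pos (hex i)]
      rw [hZx]; exact hx
  have hle1 : ∑ x ∈ univ.filter (fun x => 1 - δ ≤ (1 / (N : ℝ)) * ∑ i, p (x i) / q (x i)), Q x
      ≤ ∑ x ∈ univ.filter (fun x => ∃ i, a < p (x i) / q (x i)), Q x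
        + ∑ x ∈ univ.filter (fun x => 1 - δ ≤ Z x), Q x := by
    rw [← sum_union_inter]
    have hsub : univ.filter (fun x => 1 - δ ≤ (1 / (N : ℝ)) * ∑ i, p (x i) / q (x i))
        ⊆ univ.filter (fun x => ∃ i, a < p (x i) / q (x i))
          ∪ univ.filter (fun x => 1 - δ ≤ Z x) := by
      intro x hx
      rw [mem_union, mem_filter, mem_filter]
      rcases hsplit x (mem_filter.mp hx).2 with h | h
      · exact Or.inl ⟨mem_univ _, h⟩
      · exact Or.inr ⟨mem_univ _, h⟩
    calc _ ≤ ∑ x ∈ univ.filter (fun x => ∃ i, a < p (x i) / q (x i))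
          ∪ univ.filter (fun x => 1 - δ ≤ Z x), Q x :=
          sum_le_sum_of_subset_of_nonneg hsub fun x _ _ => hQ x
      _ ≤ _ := le_add_of_nonneg_right (sum_nonneg fun x _ => hQ x)
  -- Step 2: union bound + Markov under `q`: Q{∃ i, ρ(x i) > a} ≤ N·q{ρ > a} ≤ N/a ≤ e^{−t/2}.
  have hqρ : ∑ ω, q ω * (p ω / q ω) = 1 := by
    rw [← hp1]; exact sum_congr rfl fun ω _ => by field_simp [(hq ω).ne']
  have hterm1 : ∑ x ∈ univ.filter (fun x => ∃ i, a < p (x i) / q (x i)), Q x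
      ≤ Real.exp (-t / 2) := by
    have hu := sum_filter_exists_le hQ (fun (i : Fin N) x => a < p (x i) / q (x i))
    have hi : ∀ i : Fin N, ∑ x ∈ univ.filter (fun x => a < p (x i) / q (x i)), Q x ≤ 1 / a := by
      intro i
      rw [sum_filter]
      have e1 : ∑ x, (if a < p (x i) / q (x i) then Q x else 0)
          = ∑ x, Q x * (if a < p (x i) / q (x i) then 1 else 0) :=
        sum_congr rfl fun x _ => by
          split_ifs
          · rw [mul_one]
          · rw [mul_zero]
      rw [e1, hmarg i (fun ω => if a < p ω / q ω then 1 else 0)]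
      calc ∑ ω, q ω * (if a < p ω / q ω then (1 : ℝ) else 0)
          ≤ ∑ ω, q ω * (p ω / q ω / a) := sum_le_sum fun ω _ => mul_le_mul_of_nonneg_left (by
              split_ifs with h
              · rw [le_div_iff₀ ha0, one_mul]; exact h.le
              · exact div_nonneg (hρ0 ω) ha0.le) (hq ω).le
        _ = (∑ ω, q ω * (p ω / q ω)) / a := by
            rw [sum_div]; exact sum_congr rfl fun ω _ => by ring
        _ = 1 / a := by rw [hqρ]
    calc _ ≤ ∑ i : Fin N, ∑ x ∈ univ.filter (fun x => a < p (x i) / q (x i)), Q x := hu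
      _ ≤ ∑ _i : Fin N, 1 / a := sum_le_sum fun i _ => hi i
      _ = (N : ℝ) / a := by
          rw [sum_const, card_univ, Fintype.card_fin, nsmul_eq_mul, mul_one_div]
      _ ≤ Real.exp (L - t) / a := div_le_div_of_nonneg_right hN ha0.le
      _ = Real.exp (-t / 2) := by
          rw [ha, ← Real.exp_sub]; congr 1; ring
  -- Step 3: Markov for `Z` under `Q` and the marginals: Q{Z ≥ 1−δ} ≤ E_Q Z/(1−δ) = p{ρ ≤ a}/(1−δ).
  have hEZ : ∑ x, Q x * Z x = ∑ ω, if p ω / q ω ≤ a then p ω else 0 := by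
    have e1 : ∀ x, Q x * Z x
        = (1 / (N : ℝ)) * ∑ i, Q x * (if p (x i) / q (x i) ≤ a then p (x i) / q (x i) else 0) := by
      intro x
      rw [hZdef, mul_sum, mul_sum, mul_sum]
      exact sum_congr rfl fun i _ => by ring
    simp_rw [e1]
    rw [← mul_sum, sum_comm]
    have e2 : ∀ i : Fin N, ∑ x, Q x * (if p (x i) / q (x i) ≤ a then p (x i) / q (x i) else 0)
        = ∑ ω, if p ω / q ω ≤ a then p ω else 0 := by
      intro i
      rw [hmarg i (fun ω => if p ω / q ω ≤ a then p ω / q ω else 0)]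
      exact sum_congr rfl fun ω _ => by
        split_ifs
        · field_simp [(hq ω).ne']
        · rw [mul_zero]
    simp_rw [e2]
    rw [sum_const, card_univ, Fintype.card_fin, nsmul_eq_mul, ← mul_assoc,
      one_div_mul_cancel hNr.ne', one_mul]
  have hterm2 : ∑ x ∈ univ.filter (fun x => 1 - δ ≤ Z x), Q x
      ≤ (∑ ω, if Real.log (p ω / q ω) ≤ L - t / 2 then p ω else 0) / (1 - δ) := by
    have hm := sum_filter_le_sum_mul_div hQ hZ0 (c := 1 - δ) (by linarith)
    refine hm.trans (div_le_div_of_nonneg_right ?_ (by linarith))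
    rw [hEZ]
    refine sum_le_sum fun ω _ => ?_
    by_cases hpω : p ω = 0
    · simp [hpω]
    · have hpω' : 0 < p ω := lt_of_le_of_ne (hp ω) (Ne.symm hpω)
      have hρω : 0 < p ω / q ω := div_pos hpω' (hq ω)
      have hiff : p ω / q ω ≤ a ↔ Real.log (p ω / q ω) ≤ L - t / 2 := by
        rw [ha, ← Real.log_le_log_iff hρω (Real.exp_pos _), Real.log_exp]
      by_cases hc : p ω / q ω ≤ a
      · rw [if_pos hc, if_pos (hiff.mp hc)]
      · rw [if_neg hc, if_neg (fun h => hc (hiff.mpr h))]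
  linarith [hle1, hterm1, hterm2]

/-! ## §3 The NE-MCMC reading: correlated forward evolutions with `P_F` marginals -/

section Jarzynski

variable {X : Type*} [Fintype X] [Nonempty X] {n : ℕ}

/-- **JARZYNSKI SAMPLE SIZE, NECESSITY, WITHOUT INDEPENDENCE.**  Actions `S`, positive layers with
unit row sums leaving the intermediate Boltzmann weights invariant, `ΔF = F(S_n) − F(S_0)`,
`⟨W⟩_R̃ = Σ P̃_R W`; ANY joint law `Q ≥ 0` of `N` forward evolutions each of which is distributed as
`P_F` (e.g. evolutions launched from a STATIONARY prior chain every `n_between` sweeps); any `t`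
with `N ≤ exp(ΔF − ⟨W⟩_R̃ − t)` and `δ < 1`:
`Q{Ẑ_N e^{ΔF} ≥ 1 − δ} ≤ e^{−t/2} + P̃_R{W ≥ ⟨W⟩_R̃ + t/2}/(1 − δ)` — the independent-draw theorem
`Scaling/JarzynskiSampleSize.jarzynski_sampleSize_necessary` verbatim, minus independence. -/
theorem jarzynski_sampleSize_necessary_of_marginals (S : Fin (n + 1) → X → ℝ)
    (P : Fin n → X → X → ℝ) (hPpos : ∀ k x y, 0 < P k x y)
    (hst : ∀ k : Fin n, IsStationary (fun x => Real.exp (-(S k.succ x))) (P k))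
    {N : ℕ} {Q : (Fin N → (Fin (n + 1) → X)) → ℝ} (hQ : ∀ x, 0 ≤ Q x)
    (hmarg : ∀ (i : Fin N) (g : (Fin (n + 1) → X) → ℝ),
      ∑ x, Q x * g (x i) = ∑ ω, pathLaw (gibbsLaw (S 0)) P ω * g ω)
    {t : ℝ} (hN : (N : ℝ) ≤ Real.exp ((freeEnergy (S (Fin.last n)) - freeEnergy (S 0)
      - ∑ ω, revPathLaw S P ω * work S ω) - t)) {δ : ℝ} (hδ1 : δ < 1) :
    ∑ x ∈ univ.filter (fun x => 1 - δ ≤ (1 / (N : ℝ)) * ∑ i,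
        Real.exp (-(work S (x i) - (freeEnergy (S (Fin.last n)) - freeEnergy (S 0))))), Q x
      ≤ Real.exp (-t / 2)
        + (∑ ω, if (∑ ω', revPathLaw S P ω' * work S ω') + t / 2 ≤ work S ω
            then revPathLaw S P ω else 0) / (1 - δ) := by
  classical
  have hR0 : ∀ ω, 0 ≤ revPathLaw S P ω := revPathLaw_nonneg S fun k x y => (hPpos k x y).le
  have hR1 : ∑ ω, revPathLaw S P ω = 1 := sum_revPathLaw S P hst
  have hkl := klFin_revPathLaw_pathLaw S P hPpos hst
  have h := sampleSize_necessary_of_marginals (p := revPathLaw S P) (q := pathLaw (gibbsLaw (S 0)) P)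
    (fun ω => pathLaw_pos (gibbsLaw_pos _) hPpos ω) hR0 hR1 hQ hmarg (t := t) (by rwa [hkl]) hδ1
  simp_rw [revPathLaw_div_pathLaw S P hPpos, Real.log_exp, hkl] at h
  have hiff : ∀ ω, (-(work S ω - (freeEnergy (S (Fin.last n)) - freeEnergy (S 0)))
      ≤ freeEnergy (S (Fin.last n)) - freeEnergy (S 0) - ∑ ω', revPathLaw S P ω' * work S ω' - t / 2)
      ↔ ((∑ ω', revPathLaw S P ω' * work S ω') + t / 2 ≤ work S ω) := fun ω => by
    constructor <;> intro h <;> linarith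
  simp_rw [hiff] at h
  exact h

end Jarzynski

end Summit.Ventures.LatticeQCDFlow.Theory2
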